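import Literature.IUT.HodgeArakelov.GaloisPairRigidityRmk1111bGenuine
import Literature.AnabelianGeometry.AbsoluteAnabelian.AbsTopIII.EquivariantSignRigidity
import HarnessLib

/-!
# [IUTchII] Rmk 1.11.1 (i) (b) at the genuine producers, complement: the `Ẑ^×`-action on `O^×(G)` is FAITHFUL, so the
# kernel of `Aut(G ↷ O^×(G)) → Aut(G)` is `Ẑ^×` ON THE NOSE (proof-only)

S. Mochizuki, *Inter-universal Teichmüller theory II*, §1, Remark 1.11.1 (i) (b), kurims manuscript (Dec. 2020) p. 50
(«kernel given by the [`G`-linear] automorphisms … determined by the natural action of `Ẑ^×` [cf. [AbsTopIII], Proposition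
3.3, (ii)]») [claim: Mochizuki2012, status: disputed] (IUTchII §1 Rmk 1.11.1 (i), kurims p.50); [AbsTopIII] Prop. 3.3 (ii)
p. 74: for `T = TCG` the map `Isom((Π ↷ M),(Π* ↷ M*)) → Isom(Π,Π*) × Isom(μ_Ẑ(M), μ_Ẑ(M*))` «is a bijection»
[MochizukiAbsTopIII2015]. abc-iut cell, layer L6, seat abc-iut-w6-d010, row «RMK1111B-GENUINE», file C (sequel of
p431139 / p431864). PROOF-ONLY (no `def` / `structure` / `instance`).

* `Genuine.zhatUnitAut_injective`, `Genuine.zhatPowUnits_injective`, `Genuine.zhatPowOunits_injective` — the natural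
  `Ẑ^×`-action `u ↦ (x ↦ x^u)` on `𝒪_k̄^×` (and on `(𝒪_k̄^⊳)ˣ`) is FAITHFUL: `u` is recovered from the action on the
  primitive roots of unity `ζ_n ∈ 𝒪_k̄^×` (`ζ_n ↦ ζ_n^{χ_n(u)}`, abc-iut-L6-d1's `MLFClosure.exists_isPrimitiveRoot`) via
  abc-iut L2's `ZHatLevel.eq_of_levelChar_eq` (`Aut(Ẑ)` is determined by its level characters);
* `Genuine.zhatPowOunits_kernel_bijective` — hence, at the genuine producer, `u ↦ (1, x ↦ x^u)` is a BIJECTION from `Ẑ^×`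
  onto the automorphisms of the pair `G ↷ O^×(G)` lying over `1 ∈ Aut(G)` (injective: faithfulness; surjective: the kernel
  clause `exists_eq_zhatPowOunits_of_forget_eq_one` of file B) — [AbsTopIII] Prop. 3.3 (ii)'s «bijection» for `T = TCG`
  over the identity of `G`, at the genuine pairs `(G ↷ (𝒪_k̄^⊳)ˣ)`.

HONEST FRAMING: OUR kernel consequences of classical statements; nothing here bears on [IUTchIII] Cor. 3.12 or takes a side.
-/

noncomputable section

namespace Literature.IUT.HodgeArakelov

open CategoryTheory
open Literature.AnabelianGeometry.AbsoluteAnabelian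
open Literature.AnabelianGeometry.EtaleTheta

namespace AbsTopMonoids

namespace Genuine

variable (C : MLFClosure.{0})

/-- **FAITHFULNESS of `u ↦ (x ↦ x^u)` on `𝒪_k̄^×`**: if `x ↦ x^u` and `x ↦ x^v` coincide then `u = v` — evaluate at a
primitive `n`-th root of unity `ζ_n ∈ 𝒪_k̄^×` for every `n` (`ζ_n^{χ_n(u)} = ζ_n^{χ_n(v)}` forces `χ_n(u) = χ_n(v)`), then
`ZHatLevel.eq_of_levelChar_eq`. [cite: MochizukiAbsTopIII2015, Proposition 3.3 (ii) p.74] -/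
theorem zhatUnitAut_injective : Function.Injective (zhatUnitAut C) := by
  intro u v huv
  refine ZHatLevel.eq_of_levelChar_eq fun n => ?_
  obtain ⟨ζ, hζ⟩ := C.exists_isPrimitiveRoot n n.pos
  have hζn : ζ ^ (n : ℕ) = 1 := hζ.pow_eq_one
  let x : unitSubmonoid C.k C.K := ⟨ζ, C.rootOfUnity_mem_unitSubmonoid n.pos hζn⟩
  have hu := coe_zhatUnitAut_of_pow_eq_one C u x n n.pos hζn
  have hv := coe_zhatUnitAut_of_pow_eq_one C v x n n.pos hζn
  rw [huv] at hu
  have hpow : ζ ^ levelExp u n = ζ ^ levelExp v n := hu.symm.trans hv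
  rw [levelExp_of_pos u n.pos, levelExp_of_pos v n.pos] at hpow
  exact ZMod.val_injective _ (hζ.pow_inj (ZMod.val_lt _) (ZMod.val_lt _) hpow)

/-- The HOMOMORPHISM `Ẑ^× → Aut(𝒪_k̄^×)`, `u ↦ (x ↦ x^u)`, is injective. [cite: MochizukiAbsTopIII2015, Proposition 3.3 (ii) p.74] -/
theorem zhatPowUnits_injective : Function.Injective (zhatPowUnits C) :=
  zhatUnitAut_injective C

/-- The transported action `Ẑ^× → Aut((𝒪_k̄^⊳)ˣ)` (the `zhatPow` datum of `Rmk1111_b` at the genuine producers) is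
injective. [claim: Mochizuki2012, status: disputed] (IUTchII §1 Rmk 1.11.1 (i), kurims p.50) -/
theorem zhatPowOunits_injective : Function.Injective (zhatPowOunits C) := by
  intro u v huv
  apply zhatUnitAut_injective C
  apply MulEquiv.ext
  intro y
  have h := MulEquiv.congr_fun huv ((ModelMLFGaloisData.unitsEquivUnitSubmonoid C).symm y)
  change ((ModelMLFGaloisData.unitsEquivUnitSubmonoid C).symm
      (zhatUnitAut C u ((ModelMLFGaloisData.unitsEquivUnitSubmonoid C)
        ((ModelMLFGaloisData.unitsEquivUnitSubmonoid C).symm y)))) =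
    ((ModelMLFGaloisData.unitsEquivUnitSubmonoid C).symm
      (zhatUnitAut C v ((ModelMLFGaloisData.unitsEquivUnitSubmonoid C)
        ((ModelMLFGaloisData.unitsEquivUnitSubmonoid C).symm y)))) at h
  rw [MulEquiv.apply_symm_apply] at h
  exact (ModelMLFGaloisData.unitsEquivUnitSubmonoid C).symm.injective h

variable (S : ThetaSetting.{0}) (ε : S.Gk ≃ₜ* (ModelMLFGaloisData.galois C.k C.K).tmPair.Pi)
  (hΔ : ∀ f : S.PiX ≃ₜ* S.PiX, S.DeltaX.map f.toMulEquiv.toMonoidHom = S.DeltaX)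
  (hq : Nonempty (TopGroup.quot S.PiX S.DeltaX ≃ₜ* S.Gk))

/-- **The kernel IS `Ẑ^×`** ([AbsTopIII] Prop. 3.3 (ii) «a bijection» for `T = TCG` over the identity of `G`; [IUTchII] Rmk
1.11.1 (i) (b)): at the genuine producer, `u ↦ (1, x ↦ x^u)` is a BIJECTION from `Ẑ^×` onto the automorphisms of the pair
`G ↷ O^×(G)` lying over `1 ∈ Aut(G)` — injective by faithfulness, surjective by the kernel clause of file B.
[claim: Mochizuki2012, status: disputed] (IUTchII §1 Rmk 1.11.1 (i), kurims p.50) -/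
theorem zhatPowOunits_kernel_bijective (G : IsoClass S.Gk) :
    Function.Bijective fun u : ZHatUnits =>
      (⟨⟨((1 : Aut G), zhatPowOunits C u), one_zhatPowOunits_mem_pairAut C S ε hΔ hq G u⟩, rfl⟩ :
        {p : PairAut G ((genuineOfModel S C ε hΔ hq).Ounits G) ((genuineOfModel S C ε hΔ hq).actOunits G) //
          PairAut.forget p = 1}) := by
  constructor
  · intro u v huv
    apply zhatPowOunits_injective C
    have h := congrArg (fun q : {p : PairAut G ((genuineOfModel S C ε hΔ hq).Ounits G)
        ((genuineOfModel S C ε hΔ hq).actOunits G) // PairAut.forget p = 1} => q.1.1.2) huv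
    exact h
  · rintro ⟨p, hp⟩
    obtain ⟨u, hu⟩ := exists_eq_zhatPowOunits_of_forget_eq_one C S ε hΔ hq G p hp
    refine ⟨u, Subtype.ext (Subtype.ext (Prod.ext ?_ ?_))⟩
    · exact hp.symm
    · exact hu.symm

end Genuine

end AbsTopMonoids

end Literature.IUT.HodgeArakelov

end
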